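/-
Copyright (c) 2026 the pub-hodgecm-mathlib formalisation cell (harness21).  Prover seat hodgecm-mathlib-F0P3b-p01 (g25); E1 keeper ∕ dealer F0P3a-p03 (g29), E1 BRICK
LEDGER row 40 D «K2′-π² SELF-EXTENSION SPLIT @ DATUM» (deal 2026-09-03T01:32:53Z; census `F0/P2/p02/g25/k2pi2/CENSUS-K2PI2-SELFEXT.v1` eb22afb6 §0-D, F0P2-p02 (g25)).
-/
import Literature.RepresentationTheory.SelfExtensionSplitting                   -- ★ row 40 G2 (F0P2-p02 (g26)): `exists_section_of_two_le_finrank_or_exists_jet` (the assembly «alternative ⇒ split, given (ND)»)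
import Literature.NumberTheory.Automorphic.SmoothInductionFrobeniusNaturality   -- ★ FN p852974: `frobeniusNormalized_symm_apply` (the normalised Frobenius equivalence `E`, `E⁻¹`; brings `frobeniusEquiv`, `normalizedJacquetHomEquiv`)
import Literature.NumberTheory.Automorphic.JacquetNonzeroEmbedsNormalizedInd    -- ★ `deltaChar_cmBorelTriple_eq_one_of_mem_N` (`hδ` at the CM Borel; brings ★ `UnitaryGroupBorelInduction`: `cmBorelTriple`)
import Summits.HodgeConjecture.HodgeConjecture.Theorems.F0P3cStCharTSJetAtDatum -- ★ row 27 J2 (F0P2-p02 (g25)): `twist_comp_proj_unipotentModel_apply` (brings ★ J1 `exists_linearEquiv_smoothInd_unipotentModel`, `smoothIndRep_unipotentModel_transport`)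
import Summits.HodgeConjecture.HodgeConjecture.Theorems.F0P3cStCharTSJetWindowAtDatum -- ★ row 27c JW (this seat) p853263: `jet_one_eq_zero_and_leibniz_normalizedInd`
import HarnessLib

/-!
# K2′-π²: a smooth self-extension of `A ⊂ i_B(σ₀)` SPLITS, given (ND) and the Jacquet alternative — the DATUM FORK («`r_B E ≅ χ ⊕ χ` or `N_λ`») read through Frobenius and the height jet

Cell `pub/hodgecm-mathlib`, crux H413 = `stmt-HodgeConjecture-24833` (`--supports` lane, helper, THEOREMS ONLY: no definition ∕ instance ∕ notation ∕ named fact ∕ `sorry`).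
Namespace `Summit.HodgeConjecture.HodgeConjecture.Cruxes.H413.F0P3cStCharTSK2PiTwoSelfExtSplit`.  E1 BRICK LEDGER (F0P3a-p03 (g29)) row 40 D — the datum fork of the K2′-π²
self-extension assembly (census K2PI2-SELFEXT v1 §0-D; generic layers ★ G1 `JetEmbeddingExclusion` p853217 and ★ G2 `SelfExtensionSplitting`, F0P2-p02 (g25∕g26)).  Seat F0P3b-p01 (g25).

THE MATHEMATICS.  `G ⊇ P = MN` a parabolic triple `t` (`[LocallyCompactSpace P]`, `δ_P|_N = 1` — `hδ`; at the CM datum `t := cmBorelTriple L N v`, `G = U(Φ_N)(L⁺_v)`, `hδ` = ★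
`deltaChar_cmBorelTriple_eq_one_of_mem_N`), `σ₀` a representation of `M` on `W₀` (`σ₀ = χ̃_ξ` for K2′-π²), `I₀ := i_P(σ₀) = normalizedInd t σ₀` on
`V := SmoothInd t.P (σ₀ ∘ proj ⊗ δ^{1/2})`, `N₀` the unipotent model `σ₀ ⊗ [[1, λ],[0, 1]]` on `W₀ × W₀` (`hN₀`, JET letters: sub `0 × W₀`, quotient = first coordinate), `Λ` a height
(`hΛ : Λ(p g) = λ(proj p) + Λ g`, right-invariant under an open `KΛ` — ★ H2 `exists_height_cmBorel` at the datum), and `(π₁, ρ)` ANY pair with the height-jet formula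
`(π₁ g v)(x) = (Λ(xg) − Λ x)·v(xg)` and the jet shape `ρ g (v₀, v₁) = (I₀ g v₀, π₁ g v₀ + I₀ g v₁)` (★ J2's package supplies one; hypothesis-style so that the consumer's (ND) speaks
about THE SAME `π₁`).  Let `τ` be a SMOOTH representation on `X` (`hτ`) and `E := (frobeniusEquiv hτ).trans (normalizedJacquetHomEquiv t τ σ hδ) : Hom_G(τ, i_P σ) ≃ₗ Hom_M(r_P τ, σ)`
the normalised Frobenius equivalence (★ FN: `E(T)[x] = (T x)(1)`, `(E⁻¹ ψ x)(g) = ψ [τ g x]`, both `rfl`).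
* §1 (D1) **`two_le_finrank_intertwiningMap_normalizedInd_of_jacquet`**: `2 ≤ dim Hom_M(r_P τ, σ₀) ⇒ 2 ≤ dim Hom_G(τ, I₀)` (`E.finrank_eq`).
* §1 (D2) **`exists_equivariant_jet_fst_ne_zero_of_jacquet`**: an `M`-map `θ : r_P τ → N₀` NOT landing in the sub `0 × W₀` (`∃ y, (θ y).1 ≠ 0`) gives `φ := Ψ ∘ E⁻¹θ : X → V × V`
  EQUIVARIANT into `ρ` with `fst ∘ φ ≠ 0` — `Ψ : i_P(N₀) ≃ V × V` the height trivialisation (★ J1 (H1) at `H := P`, `hρN` = ★ J2 `twist_comp_proj_unipotentModel_apply`), its transport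
  (★ J1 (H3), valid for ANY `π₁` with the formula) + `hρ` give equivariance; if `fst ∘ φ = 0` then `(θ [x]).1 = ((E⁻¹θ x)(1)).1 = (φ x).1(1) = 0` for every `x`, so `θ` lands in
  `0 × W₀` by `Coinvariants.mk_surjective` — contradiction.
* §1 (F) **`exists_equivariant_jet_of_jacquet_sub`** — the SAME `φ` with its SUB WITNESS for the K4′ twin (★ G3 `two_le_finrank_intertwiningMap_of_jet_sign`): if moreover
  `θ ∘ r_P(ι)` lands in the sub `0 × W₀` (`hsub`) and is non-zero (`hne`), then `(φ ∘ ι)₁ = 0` and `φ ∘ ι ≠ 0` (keeper ruling 02:11:49Z (d), «F2 in D»).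
* §1 (D3) **`exists_section_selfExtension_of_jacquet_alternative`**: for a self-extension `0 → A —ι→ τ —p→ A → 0` of an invariant irreducible `A ≤ I₀` with `Hom_G(A, I₀ ∕ A) = 0`, Schur
  `dim End_G(A) = 1`, (ND) `hnd` («`A` does not deform to first order along `(I₀, π₁)`», ★ row 32's letters VERBATIM), and the JACQUET ALTERNATIVE
  **(d1′) `hJ : 2 ≤ dim Hom_M(r_P τ, σ₀) ∨ ∃ θ : r_P τ → N₀, ∃ y, (θ y).1 ≠ 0`** («`r_P τ` is `χ ⊕ χ` or `N_λ`»): **`τ` SPLITS** — `∃ s, p ∘ s = id` — by ★ G2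
  `exists_section_of_two_le_finrank_or_exists_jet` fed with (D1)∕(D2) and `h1 hL` from ★ JW `jet_one_eq_zero_and_leibniz_normalizedInd`.
* §2 AT THE CM DATUM (`hδ` DISCHARGED): `two_le_finrank_intertwiningMap_normalizedInd_of_jacquet_cmBorel`, **`exists_equivariant_jet_fst_ne_zero_of_jacquet_cmBorel`** — the two
  branches of ★ G2's `halt` on `U(Φ_N)(L⁺_v)`; the ASSEMBLY (D3) is applied at the datum by ONE application `… (cmBorelTriple L N v) (deltaChar_cmBorelTriple_eq_one_of_mem_N L N v) …`
  inside the consumer's proof (re-spelling its statement with `(normalizedInd (cmBorelTriple …) σ₀).subrepresentation` in the binders hits the whnf wall of ★ J2's §3 note —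
  measured again here; see the HOME cert `CERT.datum.D3` of this row).
INPUTS CARRIED VERBATIM AS HYPOTHESES (PRINT, not discharged here): (ND) `hnd` — the simple zero ∕ non-scalar `𝒜₀` [Keys1984]; (d1) `hAirr`, `hHom0`, `hSchur` for `A = π²(ξ) ⊂ i_B(χ_ξ)`
[Rogawski1990, §12.2], [Casselman1995, §6.3]; (d1′) `hJ` — from `r_B` exact (★ `jacquetMap_exact`∕`_injective`∕`_surjective`), `dim r_B π²(ξ) = 1` [Keys1984] and the self-extension
dichotomy of a character (★ `CharacterSelfExtensionModel.unipotent_model_split_iff` ∕ `exists_linearEquiv_unipotent_model`) — the brick D′, not this file.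
[cite: Keys1984, §3 pp. 118–119] [cite: BernsteinZelevinsky1977, Proposition 1.9(b), p. 445; §2.3] [cite: Casselman1995, §3.2; §6.3] [cite: Rogawski1990, §12.2 p. 173]
[cite: HuybrechtsLehn1997, App. 2.A.7 (Flags of subsheaves)]
HONEST LABEL: count-neutral datum assembly modulo (ND), (d1), (d1′); h413 OPEN; HC_CM is proved only modulo the 7 printed citations (2 remaining named inputs hLiu418 =
stmt-HodgeConjecture-24832, h413 = stmt-HodgeConjecture-24833) until rung 0 closes.

## References
* [Keys1984] D. Keys, *Principal series representations of special unitary groups over local fields*, Compositio Math. 51 (1984), §3 pp. 118–119.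
* [BernsteinZelevinsky1977] I. N. Bernstein, A. V. Zelevinsky, *Induced representations of reductive p-adic groups I*, Ann. Sci. ÉNS 10 (1977), Prop. 1.9 (b) p. 445, §2.3.
* [Casselman1995] W. Casselman, *Introduction to the theory of admissible representations of p-adic reductive groups* (1995), §3.2, §6.3.
* [Rogawski1990] J. D. Rogawski, *Automorphic Representations of Unitary Groups in Three Variables*, Ann. of Math. Stud. 123 (1990), §12.2 p. 173.
* [HuybrechtsLehn1997] D. Huybrechts, M. Lehn, *The Geometry of Moduli Spaces of Sheaves* (1997), Appendix 2.A.7.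
-/

set_option autoImplicit false

set_option linter.dupNamespace false

noncomputable section

open NumberField IsDedekindDomain

namespace Summit.HodgeConjecture.HodgeConjecture.Cruxes.H413.F0P3cStCharTSK2PiTwoSelfExtSplit

open Literature.NumberTheory.Automorphic Literature.NumberTheory.Automorphic.UnitaryGroup Representation Literature.RepresentationTheory
open Summit.HodgeConjecture.HodgeConjecture.Cruxes.H413

/-! ## §1 Any parabolic triple `t` with `δ_P|_N = 1` -/

section AnyTriple

variable {G : Type*} [Group G] [TopologicalSpace G] [IsTopologicalGroup G] (t : ParabolicTriple G) [LocallyCompactSpace ↥t.P]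
  (hδ : ∀ (n : G) (hn : n ∈ t.N), deltaChar t.P ⟨n, t.N_le hn⟩ = 1)
  {W₀ : Type*} [AddCommGroup W₀] [Module ℂ W₀] (σ₀ : Representation ℂ ↥t.M W₀)
  {X : Type*} [AddCommGroup X] [Module ℂ X] (τ : Representation ℂ G X)

include hδ in
/-- **(D1) `2 ≤ dim_ℂ Hom_M(r_P τ, σ₀) ⇒ 2 ≤ dim_ℂ Hom_G(τ, i_P σ₀)`** — the normalised Frobenius equivalence `E : Hom_G(τ, i_P σ₀) ≃ₗ[ℂ] Hom_M(r_P τ, σ₀)` preserves `finrank`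
(the SPLIT branch «`r_P τ ≅ χ ⊕ χ`» of the Jacquet alternative, read on the `G`-side as ★ G2's `2 ≤ finrank`). [cite: BernsteinZelevinsky1977, Proposition 1.9(b), p. 445] [cite: Casselman1995, §3.2] -/
theorem two_le_finrank_intertwiningMap_normalizedInd_of_jacquet (hτ : τ.IsSmooth)
    (h2 : 2 ≤ Module.finrank ℂ (IntertwiningMap (τ.normalizedJacquet t) σ₀)) :
    2 ≤ Module.finrank ℂ (IntertwiningMap τ (Representation.normalizedInd t σ₀)) := by
  have hE := LinearEquiv.finrank_eq ((frobeniusEquiv (H := t.P) (σ := Representation.twist (σ₀.comp t.proj) (rootDeltaChar t.P)) hτ).trans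
    (normalizedJacquetHomEquiv t τ σ₀ hδ))
  exact h2.trans_eq hE.symm

variable (lam : ↥t.M → ℂ) (N₀ : Representation ℂ ↥t.M (W₀ × W₀))
  (hN₀ : ∀ (m : ↥t.M) (w : W₀ × W₀), N₀ m w = (σ₀ m w.1, lam m • σ₀ m w.1 + σ₀ m w.2))
  (Λ : G → ℂ) (hΛ : ∀ (p : ↥t.P) (g : G), Λ ((p : G) * g) = lam (t.proj p) + Λ g)
  (KΛ : Subgroup G) (hKΛ : IsOpen (KΛ : Set G)) (hΛK : ∀ (x κ : G), κ ∈ KΛ → Λ (x * κ) = Λ x)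
  (π₁ : G → Module.End ℂ (SmoothInd t.P (Representation.twist (σ₀.comp t.proj) (rootDeltaChar t.P))))
  (hπ₁ : ∀ (g : G) (w : SmoothInd t.P (Representation.twist (σ₀.comp t.proj) (rootDeltaChar t.P))) (x : G),
    (π₁ g w).toFun x = (Λ (x * g) - Λ x) • w.toFun (x * g))
  (ρ : Representation ℂ G (SmoothInd t.P (Representation.twist (σ₀.comp t.proj) (rootDeltaChar t.P)) ×
    SmoothInd t.P (Representation.twist (σ₀.comp t.proj) (rootDeltaChar t.P))))
  (hρ : ∀ g v₀ v₁, ρ g (v₀, v₁) = (Representation.normalizedInd t σ₀ g v₀, π₁ g v₀ + Representation.normalizedInd t σ₀ g v₁))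

include hδ hN₀ hΛ hKΛ hΛK hπ₁ hρ in
/-- **(D2) THE JET BRANCH** («`r_P τ ≅ N_λ`» read on the `G`-side).  An `M`-map `θ : r_P τ → N₀ = σ₀ ⊗ [[1, λ],[0, 1]]` that does NOT land in the sub `0 × W₀` yields an
EQUIVARIANT `φ : X → i_P σ₀ × i_P σ₀` into the height jet `ρ` of `(i_P σ₀, π₁)` with NON-ZERO FIRST COMPONENT: `φ := Ψ ∘ E⁻¹θ`, `E` the normalised Frobenius equivalence at `σ := N₀`,
`Ψ` the height trivialisation `i_P N₀ ≃ i_P σ₀ × i_P σ₀` (★ J1 (H1)∕(H3) at `H := P`, ★ J2 `twist_comp_proj_unipotentModel_apply`); `(φ x).1(1) = ((E⁻¹θ x)(1)).1 = (θ [x]).1`.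
[cite: Keys1984, §3 pp. 118–119] [cite: BernsteinZelevinsky1977, Proposition 1.9(b), p. 445; §2.3] -/
theorem exists_equivariant_jet_fst_ne_zero_of_jacquet (hτ : τ.IsSmooth) (θ : IntertwiningMap (τ.normalizedJacquet t) N₀) (hθ : ∃ y, (θ y).1 ≠ 0) :
    ∃ φ : X →ₗ[ℂ] SmoothInd t.P (Representation.twist (σ₀.comp t.proj) (rootDeltaChar t.P)) × SmoothInd t.P (Representation.twist (σ₀.comp t.proj) (rootDeltaChar t.P)),
      (∀ (g : G) (x : X), φ (τ g x) = ρ g (φ x)) ∧ ∃ x, (φ x).1 ≠ 0 := by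
  -- the height trivialisation `Ψ : i_P N₀ ≃ i_P σ₀ × i_P σ₀` (★ J1 (H1) at `H := P`, the inflated-twisted `N₀` has the jet shape by ★ J2)
  obtain ⟨Ψ, hΨ, -⟩ := exists_linearEquiv_smoothInd_unipotentModel t.P (Representation.twist (σ₀.comp t.proj) (rootDeltaChar t.P))
    (fun p => lam (t.proj p)) (Representation.twist (N₀.comp t.proj) (rootDeltaChar t.P))
    (F0P3cStCharTSJetAtDatum.twist_comp_proj_unipotentModel_apply t σ₀ lam N₀ hN₀) Λ hΛ KΛ hKΛ hΛK
  -- `φ₀ := E⁻¹ θ : τ → i_P N₀`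
  let φ₀ : IntertwiningMap τ (Representation.normalizedInd t N₀) :=
    ((frobeniusEquiv (H := t.P) (σ := Representation.twist (N₀.comp t.proj) (rootDeltaChar t.P)) hτ).trans
      (normalizedJacquetHomEquiv t τ N₀ hδ)).symm θ
  have hφ₀1 : ∀ x : X, ((φ₀ x).toFun 1) = θ (Coinvariants.mk (t.restrict τ) x) := fun x => by
    have h := frobeniusNormalized_symm_apply t N₀ hτ hδ θ x 1
    rw [map_one, Module.End.one_apply] at h
    exact h
  refine ⟨Ψ.toLinearMap ∘ₗ φ₀.toLinearMap, fun g x => ?_, ?_⟩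
  · -- equivariance: `φ₀` intertwines, `Ψ` transports `i_P N₀` to the jet of `(i_P σ₀, π₁)` (★ J1 (H3), ANY `π₁` with the formula), `hρ`
    rw [LinearMap.comp_apply, LinearMap.comp_apply, LinearEquiv.coe_coe, IntertwiningMap.toLinearMap_apply, IntertwiningMap.toLinearMap_apply,
      IntertwiningMap.isIntertwining _ _ φ₀ g x]
    change Ψ (smoothIndRep t.P (Representation.twist (N₀.comp t.proj) (rootDeltaChar t.P)) g (φ₀ x)) = _
    rw [smoothIndRep_unipotentModel_transport t.P (Representation.twist (σ₀.comp t.proj) (rootDeltaChar t.P))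
      (Representation.twist (N₀.comp t.proj) (rootDeltaChar t.P)) Λ Ψ hΨ π₁ hπ₁ g (φ₀ x), hρ]
    rfl
  · -- non-vanishing of the first component: else `θ` lands in `0 × W₀`
    obtain ⟨y, hy⟩ := hθ
    by_contra hall
    push Not at hall
    apply hy
    obtain ⟨x, rfl⟩ := Coinvariants.mk_surjective (t.restrict τ) y
    have hx : (Ψ (φ₀ x)).1 = 0 := by
      have := hall x
      rwa [LinearMap.comp_apply, LinearEquiv.coe_coe, IntertwiningMap.toLinearMap_apply] at this
    have h1 : ((Ψ (φ₀ x)).1).toFun 1 = ((φ₀ x).toFun 1).1 := (hΨ (φ₀ x) 1).1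
    rw [hx, hφ₀1 x] at h1
    exact h1.symm.trans rfl

include hδ hN₀ hΛ hKΛ hΛK hπ₁ hρ in
/-- **(F) THE JET BRANCH WITH ITS SUB WITNESS** (the K4′ twin's input for ★ G3 `two_le_finrank_intertwiningMap_of_jet_sign`, SAME `φ` as (D2)).  If moreover `ι : σA → τ` is
equivariant and `θ ∘ r_P(ι)` LANDS IN THE SUB `0 × W₀` of `N₀` (`hsub`, primitive form: `(θ [ι a]).1 = 0`) and is NON-ZERO (`hne`) — at the datum: `r_B(ι) : r_B A ≅ χ → r_B τ ≅ N_λ` hits the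
unique stable line of the non-split `N_λ` (★ LENGTH-TWO) and `r_B` is injective on injections (★ `jacquetMap_cmBorel_injective`) —, then `φ := Ψ ∘ E⁻¹θ` is equivariant into the height jet
with `fst ∘ φ ≠ 0`, `(φ ∘ ι)₁ = 0` and `φ ∘ ι ≠ 0` (so `(φ (ι a)).2 ≠ 0` for some `a`): `(φ (ι a)).1` has underlying function `g ↦ (θ [τ g (ι a)]).1 = (θ [ι (σA g a)]).1 = 0`, and
`(E⁻¹θ (ι a))(1) = θ [ι a]`. [cite: Keys1984, §3 pp. 118–119] [cite: BernsteinZelevinsky1977, Proposition 1.9(b), p. 445; §2.3] [cite: Casselman1995, §3.2] -/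
theorem exists_equivariant_jet_of_jacquet_sub (hτ : τ.IsSmooth) {Y : Type*} [AddCommGroup Y] [Module ℂ Y] (σA : Representation ℂ G Y)
    (ι : IntertwiningMap σA τ) (θ : IntertwiningMap (τ.normalizedJacquet t) N₀) (hθ : ∃ y, (θ y).1 ≠ 0)
    (hsub : ∀ a : Y, (θ (Coinvariants.mk (t.restrict τ) (ι a))).1 = 0) (hne : ∃ a : Y, θ (Coinvariants.mk (t.restrict τ) (ι a)) ≠ 0) :
    ∃ φ : X →ₗ[ℂ] SmoothInd t.P (Representation.twist (σ₀.comp t.proj) (rootDeltaChar t.P)) × SmoothInd t.P (Representation.twist (σ₀.comp t.proj) (rootDeltaChar t.P)),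
      (∀ (g : G) (x : X), φ (τ g x) = ρ g (φ x)) ∧ (∃ x, (φ x).1 ≠ 0) ∧ (∀ a : Y, (φ (ι a)).1 = 0) ∧ ∃ a : Y, (φ (ι a)).2 ≠ 0 := by
  obtain ⟨Ψ, hΨ, -⟩ := exists_linearEquiv_smoothInd_unipotentModel t.P (Representation.twist (σ₀.comp t.proj) (rootDeltaChar t.P))
    (fun p => lam (t.proj p)) (Representation.twist (N₀.comp t.proj) (rootDeltaChar t.P))
    (F0P3cStCharTSJetAtDatum.twist_comp_proj_unipotentModel_apply t σ₀ lam N₀ hN₀) Λ hΛ KΛ hKΛ hΛK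
  let φ₀ : IntertwiningMap τ (Representation.normalizedInd t N₀) :=
    ((frobeniusEquiv (H := t.P) (σ := Representation.twist (N₀.comp t.proj) (rootDeltaChar t.P)) hτ).trans
      (normalizedJacquetHomEquiv t τ N₀ hδ)).symm θ
  have hφ₀g : ∀ (x : X) (g : G), ((φ₀ x).toFun g) = θ (Coinvariants.mk (t.restrict τ) (τ g x)) := fun x g =>
    frobeniusNormalized_symm_apply t N₀ hτ hδ θ x g
  have hφ₀1 : ∀ x : X, ((φ₀ x).toFun 1) = θ (Coinvariants.mk (t.restrict τ) x) := fun x => by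
    rw [hφ₀g, map_one, Module.End.one_apply]
  have hφeq : ∀ (g : G) (x : X), (Ψ.toLinearMap ∘ₗ φ₀.toLinearMap) (τ g x) = ρ g ((Ψ.toLinearMap ∘ₗ φ₀.toLinearMap) x) := fun g x => by
    rw [LinearMap.comp_apply, LinearMap.comp_apply, LinearEquiv.coe_coe, IntertwiningMap.toLinearMap_apply, IntertwiningMap.toLinearMap_apply,
      IntertwiningMap.isIntertwining _ _ φ₀ g x]
    change Ψ (smoothIndRep t.P (Representation.twist (N₀.comp t.proj) (rootDeltaChar t.P)) g (φ₀ x)) = _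
    rw [smoothIndRep_unipotentModel_transport t.P (Representation.twist (σ₀.comp t.proj) (rootDeltaChar t.P))
      (Representation.twist (N₀.comp t.proj) (rootDeltaChar t.P)) Λ Ψ hΨ π₁ hπ₁ g (φ₀ x), hρ]
    rfl
  -- `(φ (ι a)).1 = 0`: its underlying function is `g ↦ (θ [τ g (ι a)]).1 = (θ [ι (σA g a)]).1 = 0`
  have hfst0 : ∀ a : Y, (Ψ (φ₀ (ι a))).1 = 0 := fun a => by
    refine SmoothInd.ext (funext fun g => ?_)
    rw [(hΨ (φ₀ (ι a)) g).1, hφ₀g, ← IntertwiningMap.isIntertwining _ _ ι g a, hsub]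
    rfl
  refine ⟨Ψ.toLinearMap ∘ₗ φ₀.toLinearMap, hφeq, ?_, fun a => ?_, ?_⟩
  · -- `fst ∘ φ ≠ 0` as in (D2)
    obtain ⟨y, hy⟩ := hθ
    by_contra hall
    push Not at hall
    apply hy
    obtain ⟨x, rfl⟩ := Coinvariants.mk_surjective (t.restrict τ) y
    have hx : (Ψ (φ₀ x)).1 = 0 := by
      have := hall x
      rwa [LinearMap.comp_apply, LinearEquiv.coe_coe, IntertwiningMap.toLinearMap_apply] at this
    have h1 : ((Ψ (φ₀ x)).1).toFun 1 = ((φ₀ x).toFun 1).1 := (hΨ (φ₀ x) 1).1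
    rw [hx, hφ₀1 x] at h1
    exact h1.symm.trans rfl
  · rw [LinearMap.comp_apply, LinearEquiv.coe_coe, IntertwiningMap.toLinearMap_apply]
    exact hfst0 a
  · -- `φ ∘ ι ≠ 0`: at `a` with `θ [ι a] ≠ 0`, `φ₀ (ι a) ≠ 0` (value at `1`), `Ψ` injective, first component `0`
    obtain ⟨a, ha⟩ := hne
    refine ⟨a, fun h2 => ha ?_⟩
    have hΨ0 : Ψ (φ₀ (ι a)) = 0 := Prod.ext (hfst0 a) (by
      rw [LinearMap.comp_apply, LinearEquiv.coe_coe, IntertwiningMap.toLinearMap_apply] at h2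
      exact h2)
    have hφ0 : φ₀ (ι a) = 0 := Ψ.injective (by rw [hΨ0, map_zero])
    rw [← hφ₀1 (ι a), hφ0]
    rfl

include hδ hN₀ hΛ hKΛ hΛK hπ₁ hρ in
/-- **(D3) A SELF-EXTENSION OF `A ⊂ i_P(σ₀)` SPLITS, GIVEN (ND) AND THE JACQUET ALTERNATIVE.**  Let `A ≤ I₀ := i_P(σ₀)` be invariant and irreducible with `Hom_G(A, I₀ ∕ A) = 0` and Schur
`dim End_G(A) = 1` ((d1), PRINT), assume (ND) `hnd` along the height jet `(I₀, π₁)` ([Keys1984], ★ row 32's letters verbatim), and let `0 → A —ι→ τ —p→ A → 0` be a SMOOTH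
self-extension (`p` surjective, `ker p = range ι`).  If the JACQUET ALTERNATIVE (d1′) holds — `2 ≤ dim Hom_M(r_P τ, σ₀)` («`r_P τ ≅ χ ⊕ χ`») OR some `M`-map `r_P τ → N₀` misses the
sub `0 × W₀` («`r_P τ ≅ N_λ`») — then **`p` has an equivariant section: `τ` SPLITS.**  ★ G2 `exists_section_of_two_le_finrank_or_exists_jet` ∘ (D1)∕(D2), `h1 hL` by ★ JW.
[cite: Keys1984, §3 pp. 118–119] [cite: BernsteinZelevinsky1977, Proposition 1.9(b), p. 445; §2.3] [cite: Casselman1995, §6.3] [cite: Rogawski1990, §12.2 p. 173]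
[cite: HuybrechtsLehn1997, App. 2.A.7 (Flags of subsheaves)] -/
theorem exists_section_selfExtension_of_jacquet_alternative (hτ : τ.IsSmooth)
    (A : Submodule ℂ (SmoothInd t.P (Representation.twist (σ₀.comp t.proj) (rootDeltaChar t.P))))
    (hAinv : ∀ g, A ≤ A.comap (Representation.normalizedInd t σ₀ g))
    (hAirr : ∀ B : Submodule ℂ (SmoothInd t.P (Representation.twist (σ₀.comp t.proj) (rootDeltaChar t.P))), B ≤ A →
      (∀ g, B ≤ B.comap (Representation.normalizedInd t σ₀ g)) → B = ⊥ ∨ B = A)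
    (hnd : ¬ ∃ Lft : A →ₗ[ℂ] SmoothInd t.P (Representation.twist (σ₀.comp t.proj) (rootDeltaChar t.P)), ∀ (g : G) (a : A),
      π₁ g (a : SmoothInd t.P (Representation.twist (σ₀.comp t.proj) (rootDeltaChar t.P))) + Representation.normalizedInd t σ₀ g (Lft a) -
        Lft ((Representation.normalizedInd t σ₀).subrepresentation A hAinv g a) ∈ A)
    (hHom0 : ∀ ψ : IntertwiningMap ((Representation.normalizedInd t σ₀).subrepresentation A hAinv) ((Representation.normalizedInd t σ₀).quotient A hAinv), ψ = 0)
    (hSchur : Module.finrank ℂ (IntertwiningMap ((Representation.normalizedInd t σ₀).subrepresentation A hAinv)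
      ((Representation.normalizedInd t σ₀).subrepresentation A hAinv)) = 1)
    (ι : IntertwiningMap ((Representation.normalizedInd t σ₀).subrepresentation A hAinv) τ)
    (p : IntertwiningMap τ ((Representation.normalizedInd t σ₀).subrepresentation A hAinv))
    (hp : Function.Surjective p) (hexact : LinearMap.ker p.toLinearMap = LinearMap.range ι.toLinearMap)
    (hJ : 2 ≤ Module.finrank ℂ (IntertwiningMap (τ.normalizedJacquet t) σ₀) ∨
      ∃ θ : IntertwiningMap (τ.normalizedJacquet t) N₀, ∃ y, (θ y).1 ≠ 0) :
    ∃ s : IntertwiningMap ((Representation.normalizedInd t σ₀).subrepresentation A hAinv) τ,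
      p.comp s = IntertwiningMap.id ((Representation.normalizedInd t σ₀).subrepresentation A hAinv) := by
  obtain ⟨h1, hL⟩ := F0P3cStCharTSJetWindowAtDatum.jet_one_eq_zero_and_leibniz_normalizedInd t σ₀ Λ π₁ hπ₁
  refine exists_section_of_two_le_finrank_or_exists_jet (Representation.normalizedInd t σ₀) π₁ h1 hL ρ hρ A hAinv hAirr hnd hHom0 hSchur
    τ ι p hp hexact ?_
  rcases hJ with h2 | ⟨θ, hθ⟩
  · exact Or.inl (two_le_finrank_intertwiningMap_normalizedInd_of_jacquet t hδ σ₀ τ hτ h2)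
  · exact Or.inr (exists_equivariant_jet_fst_ne_zero_of_jacquet t hδ σ₀ τ lam N₀ hN₀ Λ hΛ KΛ hKΛ hΛK π₁ hπ₁ ρ hρ hτ θ hθ)

end AnyTriple

/-! ## §2 AT THE CM DATUM `t := cmBorelTriple L N v` (`G = U(Φ_N)(L⁺_v)`, `B = TN`): `hδ` discharged by ★ `deltaChar_cmBorelTriple_eq_one_of_mem_N` -/

section Datum

variable (L : Type) [Field L] [NumberField L] [IsCMField L] (N : ℕ) (v : HeightOneSpectrum (𝓞 ↥(maximalRealSubfield L)))
  [LocallyCompactSpace ↥(borelU (conjLocal L (IsCMField.complexConj L) v) (cmLocalForm L N v))]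
  {W₀ : Type*} [AddCommGroup W₀] [Module ℂ W₀] (σ₀ : Representation ℂ ↥(cmBorelTriple L N v).M W₀)
  {X : Type*} [AddCommGroup X] [Module ℂ X] (τ : Representation ℂ ↥(unitaryGroupOfForm (conjLocal L (IsCMField.complexConj L) v) (cmLocalForm L N v)) X)
  (hτ : τ.IsSmooth)

include hτ in
/-- **(D1) AT THE CM DATUM**: `2 ≤ dim Hom_T(r_B τ, σ₀) ⇒ 2 ≤ dim Hom_G(τ, i_B σ₀)` on `U(Φ_N)(L⁺_v)` (★ FN @ DATUM's `E`, `hδ` discharged).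
[cite: BernsteinZelevinsky1977, Proposition 1.9(b), p. 445] [cite: Rogawski1990, §12.2 p. 173] -/
theorem two_le_finrank_intertwiningMap_normalizedInd_of_jacquet_cmBorel
    (h2 : 2 ≤ Module.finrank ℂ (IntertwiningMap (τ.normalizedJacquet (cmBorelTriple L N v)) σ₀)) :
    2 ≤ Module.finrank ℂ (IntertwiningMap τ (Representation.normalizedInd (cmBorelTriple L N v) σ₀)) :=
  two_le_finrank_intertwiningMap_normalizedInd_of_jacquet (cmBorelTriple L N v) (deltaChar_cmBorelTriple_eq_one_of_mem_N L N v) σ₀ τ hτ h2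

variable (lam : ↥(cmBorelTriple L N v).M → ℂ) (N₀ : Representation ℂ ↥(cmBorelTriple L N v).M (W₀ × W₀))
  (hN₀ : ∀ (m : ↥(cmBorelTriple L N v).M) (w : W₀ × W₀), N₀ m w = (σ₀ m w.1, lam m • σ₀ m w.1 + σ₀ m w.2))
  (Λ : ↥(unitaryGroupOfForm (conjLocal L (IsCMField.complexConj L) v) (cmLocalForm L N v)) → ℂ)
  (hΛ : ∀ (p : ↥(cmBorelTriple L N v).P) (g : ↥(unitaryGroupOfForm (conjLocal L (IsCMField.complexConj L) v) (cmLocalForm L N v))),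
    Λ ((p : ↥(unitaryGroupOfForm (conjLocal L (IsCMField.complexConj L) v) (cmLocalForm L N v))) * g) = lam ((cmBorelTriple L N v).proj p) + Λ g)
  (KΛ : Subgroup ↥(unitaryGroupOfForm (conjLocal L (IsCMField.complexConj L) v) (cmLocalForm L N v)))
  (hKΛ : IsOpen (KΛ : Set ↥(unitaryGroupOfForm (conjLocal L (IsCMField.complexConj L) v) (cmLocalForm L N v))))
  (hΛK : ∀ (x κ : ↥(unitaryGroupOfForm (conjLocal L (IsCMField.complexConj L) v) (cmLocalForm L N v))), κ ∈ KΛ → Λ (x * κ) = Λ x)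
  (π₁ : ↥(unitaryGroupOfForm (conjLocal L (IsCMField.complexConj L) v) (cmLocalForm L N v)) →
    Module.End ℂ (SmoothInd (cmBorelTriple L N v).P (Representation.twist (σ₀.comp (cmBorelTriple L N v).proj) (rootDeltaChar (cmBorelTriple L N v).P))))
  (hπ₁ : ∀ (g : ↥(unitaryGroupOfForm (conjLocal L (IsCMField.complexConj L) v) (cmLocalForm L N v)))
    (w : SmoothInd (cmBorelTriple L N v).P (Representation.twist (σ₀.comp (cmBorelTriple L N v).proj) (rootDeltaChar (cmBorelTriple L N v).P)))
    (x : ↥(unitaryGroupOfForm (conjLocal L (IsCMField.complexConj L) v) (cmLocalForm L N v))), (π₁ g w).toFun x = (Λ (x * g) - Λ x) • w.toFun (x * g))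
  (ρ : Representation ℂ ↥(unitaryGroupOfForm (conjLocal L (IsCMField.complexConj L) v) (cmLocalForm L N v))
    (SmoothInd (cmBorelTriple L N v).P (Representation.twist (σ₀.comp (cmBorelTriple L N v).proj) (rootDeltaChar (cmBorelTriple L N v).P)) ×
      SmoothInd (cmBorelTriple L N v).P (Representation.twist (σ₀.comp (cmBorelTriple L N v).proj) (rootDeltaChar (cmBorelTriple L N v).P))))
  (hρ : ∀ g v₀ v₁, ρ g (v₀, v₁) = (Representation.normalizedInd (cmBorelTriple L N v) σ₀ g v₀, π₁ g v₀ + Representation.normalizedInd (cmBorelTriple L N v) σ₀ g v₁))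

include hτ hN₀ hΛ hKΛ hΛK hπ₁ hρ in
/-- **(D2) AT THE CM DATUM**: a `T`-map `r_B τ → N₀` missing the sub `0 × W₀` gives an equivariant `φ : X → i_B σ₀ × i_B σ₀` into the height jet with `fst ∘ φ ≠ 0` on `U(Φ_N)(L⁺_v)`
(§1 (D2), `hδ` discharged) — the `∃ φ` disjunct of ★ G2's `halt`. [cite: Keys1984, §3 pp. 118–119] [cite: BernsteinZelevinsky1977, Proposition 1.9(b), p. 445; §2.3] [cite: Rogawski1990, §12.2 p. 173] -/
theorem exists_equivariant_jet_fst_ne_zero_of_jacquet_cmBorel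
    (θ : IntertwiningMap (τ.normalizedJacquet (cmBorelTriple L N v)) N₀) (hθ : ∃ y, (θ y).1 ≠ 0) :
    ∃ φ : X →ₗ[ℂ] SmoothInd (cmBorelTriple L N v).P (Representation.twist (σ₀.comp (cmBorelTriple L N v).proj) (rootDeltaChar (cmBorelTriple L N v).P)) ×
        SmoothInd (cmBorelTriple L N v).P (Representation.twist (σ₀.comp (cmBorelTriple L N v).proj) (rootDeltaChar (cmBorelTriple L N v).P)),
      (∀ (g : ↥(unitaryGroupOfForm (conjLocal L (IsCMField.complexConj L) v) (cmLocalForm L N v))) (x : X), φ (τ g x) = ρ g (φ x)) ∧ ∃ x, (φ x).1 ≠ 0 :=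
  exists_equivariant_jet_fst_ne_zero_of_jacquet (cmBorelTriple L N v) (deltaChar_cmBorelTriple_eq_one_of_mem_N L N v) σ₀ τ lam N₀ hN₀ Λ hΛ KΛ hKΛ hΛK
    π₁ hπ₁ ρ hρ hτ θ hθ

end Datum

end Summit.HodgeConjecture.HodgeConjecture.Cruxes.H413.F0P3cStCharTSK2PiTwoSelfExtSplit

end
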